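import Summits.CriticalPhenomena.PercolationContinuityZ3.Theorems.SahiMasterFamilyPhiAffine
import Summits.CriticalPhenomena.PercolationContinuityZ3.Theorems.SahiMasterFamilyPatchSingle
import Summits.CriticalPhenomena.PercolationContinuityZ3.Theorems.SahiMasterFamilyPhiMinClosed

/-!
# `(UC-hull)` on every edge `[1_𝒰, 1_𝒱]` whose endpoint `𝒰` is ONE set away from `𝒰 ∩ 𝒱`, every order
# (`𝒱 ⊇ 𝒰 ∩ 𝒱` arbitrary union-closed): chain term + FREE-INDEX term

Unit `prim-masterthm-p4` (gen 21; crux anchor stmt-CriticalPhenomena-4575, helper work; memo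
`run/shared/lean/prim/prim-masterthm/prim-masterthm-p4/P4-GEN21-REPORT.md` §3c).  Companion of `…PhiAffine` (Φ affine along every single coordinate), `…PhiMinClosed`
(min-closed points, in particular chain mixtures, are `≥ 0`), `…PhiFreeIndex` (one free index) and `…EdgeTwo` (both endpoints one set away).

**THEOREM (every order)** `ucHull_edge_one`.  Let `𝒰, 𝒱 ∋ univ` be union-closed families of subsets of `Fin (k+1)` with `𝒰 ∖ 𝒱 = {A}` (A nonempty; `𝒱 ∖ 𝒰` arbitrary).
Then `Φ_{k+1}(w·1_𝒰 + (1−w)·1_𝒱) ≥ 0` for all `w ∈ [0,1]`.  PROOF: Φ is affine in the coordinate `β_A`, so the edge point `β = 1_𝒲 + w·e_A + (1−w)·1_{𝒱∖𝒰}`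
(`𝒲 = 𝒰 ∩ 𝒱`) satisfies `Φ(β) = w·Φ(β⁺) + (1−w)·Φ(β⁰)` with `β⁰ = 1_𝒲 + (1−w)1_{𝒱∖𝒲}` — the CHAIN mixture `w1_𝒲 + (1−w)1_𝒱`, min-closed, `≥ 0` by
`PhiMinClosed` — and `β⁺ = 1_𝒰 + (1−w)1_{𝒱∖𝒲}`, which is in general NOT min-closed (`A ∪ S'`, `S' ∈ 𝒱 ∖ 𝒰`, may lie outside `𝒰 ∪ 𝒱`) but has a FREE INDEX:
every `z ∈ A` — off `z`, `β⁺` coincides with the min-closed `β⁰`, so `PhiFreeIndex.phiSet_nonneg_of_qp_off` gives `Φ(β⁺) ≥ 0` (`phiSet_nonneg_free_over_minClosed`).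
This contains `…EdgeTwo` and all edges from a vertex to a vertex one set richer/poorer than a common union-closed subfamily; it is the second instance of the
mechanism "non-min-closed intermediate point controlled by a free index".  HONEST FRAMING: (B), `UCHullNonneg k` (k ≥ 8), Sahi's `C_k` and the master theorem remain
OPEN.  Axioms standard. [this work]
-/

noncomputable section

open scoped Classical

namespace Summit.CriticalPhenomena.PercolationContinuityZ3.Theorems

namespace EdgeOne

open Finset Function
open Literature.Combinatorics.Sahi2008
open PrincipalCapBeta (phiSet)

variable {k : ℕ}

/-- **Free index over a min-closed function.**  Let `γ : Finset (Fin (k+1)) → [0,1]` with `γ univ = 1`, and suppose that OFF some index `z` the function `γ` agrees with a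
min-closed function `c` (`γ S = c S` whenever `z ∉ S`).  Then `Φ_{k+1}(γ) ≥ 0` — whatever the values of `γ` on the sets containing `z`. [this work] -/
theorem phiSet_nonneg_free_over_minClosed (γ c : Finset (Fin (k + 1)) → ℝ) (h0 : ∀ S, 0 ≤ γ S) (h1 : ∀ S, γ S ≤ 1) (huniv : γ univ = 1)
    (hcmin : ∀ S T, min (c S) (c T) ≤ c (S ∪ T))
    (z : Fin (k + 1)) (hz : ∀ S, z ∉ S → γ S = c S) : 0 ≤ phiSet (k + 1) γ := by
  refine PhiFreeIndex.phiSet_nonneg_of_qp_off γ h1 huniv z ?_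
  set δ : Finset (Fin k) → ℝ := fun T => γ ((T.map Fin.castSuccEmb).map (Equiv.swap z (Fin.last k)).toEmbedding) with hδ
  have hδc : ∀ T, δ T = c ((T.map Fin.castSuccEmb).map (Equiv.swap z (Fin.last k)).toEmbedding) :=
    fun T => hz _ (PatchSingle.not_mem_image_swap z T)
  have hmin : ∀ S T, min (δ S) (δ T) ≤ δ (S ∪ T) := by
    intro S T
    rw [hδc, hδc, hδc, Finset.map_union, Finset.map_union]
    exact hcmin _ _
  exact PhiCylinder.qp_of_minClosed δ (fun T => h0 _) (fun T => h1 _) hmin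

/-- The chain mixture `w·1_𝒲 + (1−w)·1_𝒱` (`𝒲 ⊆ 𝒱` both union-closed) is min-closed. [this work] -/
theorem minClosed_chain (𝒲 𝒱 : Finset (Finset (Fin (k + 1)))) (hW : ∀ S ∈ 𝒲, ∀ S' ∈ 𝒲, S ∪ S' ∈ 𝒲)
    (hV : ∀ S ∈ 𝒱, ∀ S' ∈ 𝒱, S ∪ S' ∈ 𝒱) (hWV : ∀ S ∈ 𝒲, S ∈ 𝒱) {w : ℝ} (hw0 : 0 ≤ w) (hw1 : w ≤ 1) (S T : Finset (Fin (k + 1))) :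
    min (w * (if S ∈ 𝒲 then (1 : ℝ) else 0) + (1 - w) * (if S ∈ 𝒱 then (1 : ℝ) else 0))
        (w * (if T ∈ 𝒲 then (1 : ℝ) else 0) + (1 - w) * (if T ∈ 𝒱 then (1 : ℝ) else 0)) ≤
      w * (if S ∪ T ∈ 𝒲 then (1 : ℝ) else 0) + (1 - w) * (if S ∪ T ∈ 𝒱 then (1 : ℝ) else 0) := by
  have h1w : 0 ≤ 1 - w := sub_nonneg.2 hw1
  by_cases hSW : S ∈ 𝒲
  · by_cases hTW : T ∈ 𝒲
    · rw [if_pos (hW _ hSW _ hTW), if_pos (hV _ (hWV _ hSW) _ (hWV _ hTW))]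
      apply min_le_of_left_le; rw [if_pos hSW, if_pos (hWV _ hSW)]
    · by_cases hTV : T ∈ 𝒱
      · apply min_le_of_right_le
        rw [if_neg hTW, if_pos hTV, if_pos (hV _ (hWV _ hSW) _ hTV)]
        split_ifs <;> nlinarith
      · apply min_le_of_right_le
        rw [if_neg hTW, if_neg hTV]; split_ifs <;> nlinarith
  · by_cases hSV : S ∈ 𝒱
    · by_cases hTV : T ∈ 𝒱
      · apply min_le_of_left_le
        rw [if_neg hSW, if_pos hSV, if_pos (hV _ hSV _ hTV)]
        split_ifs <;> nlinarith
      · apply min_le_of_right_le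
        have hTW : T ∉ 𝒲 := fun h => hTV (hWV _ h)
        rw [if_neg hTW, if_neg hTV]; split_ifs <;> nlinarith
    · apply min_le_of_left_le
      rw [if_neg hSW, if_neg hSV]; split_ifs <;> nlinarith

/-- **`(UC-hull)` on every edge with `𝒰 ∖ 𝒱 = {A}`, every order.**  `𝒰, 𝒱 ∋ univ` union-closed, `A ∈ 𝒰 ∖ 𝒱` nonempty and every other member of `𝒰` lies in `𝒱`:
then `Φ(w·1_𝒰 + (1−w)·1_𝒱) ≥ 0` for `w ∈ [0,1]`. [this work] -/
theorem ucHull_edge_one (𝒰 𝒱 : Finset (Finset (Fin (k + 1))))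
    (hU : ∀ S ∈ 𝒰, ∀ S' ∈ 𝒰, S ∪ S' ∈ 𝒰) (hV : ∀ S ∈ 𝒱, ∀ S' ∈ 𝒱, S ∪ S' ∈ 𝒱) (hUt : univ ∈ 𝒰) (hVt : univ ∈ 𝒱)
    {A : Finset (Fin (k + 1))} (hA : A ∈ 𝒰) (hAV : A ∉ 𝒱) (hAne : A.Nonempty) (hrest : ∀ S ∈ 𝒰, S ≠ A → S ∈ 𝒱)
    {w : ℝ} (hw0 : 0 ≤ w) (hw1 : w ≤ 1) :
    0 ≤ phiSet (k + 1) (fun S => w * (if S ∈ 𝒰 then (1 : ℝ) else 0) + (1 - w) * (if S ∈ 𝒱 then (1 : ℝ) else 0)) := by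
  have h1w : 0 ≤ 1 - w := sub_nonneg.2 hw1
  -- 𝒲 = 𝒰 ∩ 𝒱 is union-closed and contained in 𝒱
  set 𝒲 := 𝒰 ∩ 𝒱 with h𝒲
  have hW : ∀ S ∈ 𝒲, ∀ S' ∈ 𝒲, S ∪ S' ∈ 𝒲 := fun S hS S' hS' =>
    mem_inter.2 ⟨hU _ (mem_inter.1 hS).1 _ (mem_inter.1 hS').1, hV _ (mem_inter.1 hS).2 _ (mem_inter.1 hS').2⟩
  have hWV : ∀ S ∈ 𝒲, S ∈ 𝒱 := fun S hS => (mem_inter.1 hS).2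
  -- the chain point β⁰ = w1_𝒲 + (1−w)1_𝒱 and the free-index point β⁺ = β⁰ + w e_A... precisely β⁺ S = β⁰ S + w [S = A]... we use the two endpoints of the A-line
  set c : Finset (Fin (k + 1)) → ℝ := fun S => w * (if S ∈ 𝒲 then (1 : ℝ) else 0) + (1 - w) * (if S ∈ 𝒱 then (1 : ℝ) else 0) with hc
  set γ : Finset (Fin (k + 1)) → ℝ := fun S => c S + (if S = A then (1 : ℝ) else 0) with hγ
  -- the edge point is the convex combination (1−w)·c + w·γ along the coordinate A
  have hedge : (fun S => w * (if S ∈ 𝒰 then (1 : ℝ) else 0) + (1 - w) * (if S ∈ 𝒱 then (1 : ℝ) else 0)) =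
      fun S => (1 - w) * c S + w * γ S := by
    funext S
    simp only [hγ, hc]
    by_cases hSA : S = A
    · subst hSA
      rw [if_pos hA, if_neg hAV, if_neg (fun h => hAV (mem_inter.1 h).2), if_pos rfl]; ring
    · rw [if_neg hSA]
      by_cases hSU : S ∈ 𝒰
      · have hSV : S ∈ 𝒱 := hrest S hSU hSA
        rw [if_pos hSU, if_pos hSV, if_pos (mem_inter.2 ⟨hSU, hSV⟩)]; ring
      · rw [if_neg hSU, if_neg (fun h => hSU (mem_inter.1 h).1)]; ring
  rw [hedge, PhiAffine.phiSet_lineMap_of_inter c γ (fun S T hST => ?_) w]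
  · -- both endpoint values are ≥ 0
    have c0 : ∀ S, 0 ≤ c S := fun S => by simp only [hc]; split_ifs <;> nlinarith
    have c1 : ∀ S, c S ≤ 1 := fun S => by simp only [hc]; split_ifs <;> nlinarith
    have cmin : ∀ S T, min (c S) (c T) ≤ c (S ∪ T) := fun S T => minClosed_chain 𝒲 𝒱 hW hV hWV hw0 hw1 S T
    have hcnn : 0 ≤ phiSet (k + 1) c := PhiMinClosed.phiSet_nonneg_of_minClosed c c0 c1 cmin
    have hcA : c A = 0 := by simp only [hc]; rw [if_neg (fun h => hAV (mem_inter.1 h).2), if_neg hAV]; ring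
    have g0 : ∀ S, 0 ≤ γ S := fun S => by simp only [hγ]; have := c0 S; split_ifs <;> linarith
    have g1 : ∀ S, γ S ≤ 1 := fun S => by
      simp only [hγ]
      by_cases hSA : S = A
      · subst hSA; rw [if_pos rfl]; simp only [hc] at hcA ⊢; linarith
      · rw [if_neg hSA, add_zero]; exact c1 S
    have guniv : γ univ = 1 := by
      have hAu : (univ : Finset (Fin (k + 1))) ≠ A := fun h => hAV (h ▸ hVt)
      simp only [hγ, hc]; rw [if_neg hAu, if_pos (mem_inter.2 ⟨hUt, hVt⟩), if_pos hVt]; ring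
    obtain ⟨z, hz⟩ := hAne
    have hγnn : 0 ≤ phiSet (k + 1) γ := phiSet_nonneg_free_over_minClosed γ c g0 g1 guniv cmin z
      (fun S hzS => by
        have hSA : S ≠ A := fun h => hzS (by rw [h]; exact hz)
        simp only [hγ]; rw [if_neg hSA, add_zero])
    exact add_nonneg (mul_nonneg h1w hcnn) (mul_nonneg hw0 hγnn)
  · -- the direction γ − c = e_A is supported on the single nonempty set A
    simp only [hγ]
    by_cases hS : S = A
    · by_cases hT : T = A
      · subst hS; subst hT
        exact absurd (Finset.disjoint_self_iff_empty _ |>.1 hST) (Finset.nonempty_iff_ne_empty.1 hAne)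
      · rw [if_neg hT]; ring
    · rw [if_neg hS]; ring

/-- The mirror statement: `𝒱 ∖ 𝒰 = {A'}`. [this work] -/
theorem ucHull_edge_one' (𝒰 𝒱 : Finset (Finset (Fin (k + 1))))
    (hU : ∀ S ∈ 𝒰, ∀ S' ∈ 𝒰, S ∪ S' ∈ 𝒰) (hV : ∀ S ∈ 𝒱, ∀ S' ∈ 𝒱, S ∪ S' ∈ 𝒱) (hUt : univ ∈ 𝒰) (hVt : univ ∈ 𝒱)
    {A' : Finset (Fin (k + 1))} (hA' : A' ∈ 𝒱) (hA'U : A' ∉ 𝒰) (hA'ne : A'.Nonempty) (hrest : ∀ S ∈ 𝒱, S ≠ A' → S ∈ 𝒰)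
    {w : ℝ} (hw0 : 0 ≤ w) (hw1 : w ≤ 1) :
    0 ≤ phiSet (k + 1) (fun S => w * (if S ∈ 𝒰 then (1 : ℝ) else 0) + (1 - w) * (if S ∈ 𝒱 then (1 : ℝ) else 0)) := by
  have h := ucHull_edge_one 𝒱 𝒰 hV hU hVt hUt hA' hA'U hA'ne hrest (sub_nonneg.2 hw1) (by linarith : 1 - w ≤ 1)
  have e : (fun S => (1 - w) * (if S ∈ 𝒱 then (1 : ℝ) else 0) + (1 - (1 - w)) * (if S ∈ 𝒰 then (1 : ℝ) else 0)) =
      fun S => w * (if S ∈ 𝒰 then (1 : ℝ) else 0) + (1 - w) * (if S ∈ 𝒱 then (1 : ℝ) else 0) := by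
    funext S; ring
  rw [e] at h
  exact h

end EdgeOne

end Summit.CriticalPhenomena.PercolationContinuityZ3.Theorems
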